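import Summits.BirchSwinnertonDyer.BirchSwinnertonDyer.Theorems.ThetaPartnerAtTwoSignedKatoUpToAtTwoLocalHonda
import Summits.BirchSwinnertonDyer.Rank1Residual.Additive.KobayashiTowerGeneration
import HarnessLib

/-!
# Route `ThetaPartnerAtTwo` (TP2), crux K3 `SignedKatoDivisibilityUpToAtTwo` (item stmt-BirchSwinnertonDyer-20308),
# line `colemanrat` v3 — THE LOCAL THEORY AT `p = 2`, file 2: the Frobenius congruence in the cyclotomic tower and Kobayashi's tower points
# `c_m ∈ E₁(ℚ_p(ζ_{p^m}))` with `Λ(c_m) = ℓ_m` at EVERY prime (the tree's odd-`p` `PadicCyclotomicIntegers` §3 /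
# `KobayashiTowerPoints` §1 with `p ≠ 2` removed)

HONEST FRAMING (cell `bsd-wall`, lead `bsd-wall-tp2-p2x` g2): THEOREMS ONLY — no definition, no named fact, no
instance, no `sorry`; pure local formal-group theory along `ℚ_p(μ_{p^∞})`; nothing about any Selmer group is
asserted; closes no item; BSD is NOT proved by any of this.

## Why this file

Second port of the tree's odd-`p` Kobayashi local series to every prime (see file 1,
`…SignedKatoUpToAtTwoLocalHonda`): in `KobayashiTowerPoints` / `KobayashiTowerGeneration` the hypothesis `p ≠ 2`
enters (a) through the Honda isomorphism (file 1) and (b) at ONE arithmetic spot, the Frobenius congruence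
`(ζ − 1)ᵖ ≡ ζᵖ − 1 (mod p)` in `𝒪_{ℚ_p(ζ_{p^m})}`, proved in the tree with `(−1)ᵖ = −1`; at `p = 2` the extra term
`(−1)² + 1 = 2 = p` is again `≡ 0 (mod p)` (`exists_frob_mem_layer_pred'` below). Everything else in those files
(`ell`, the trace identity `∑ σℓ_{m+1} = −p − ℓ_{m−1}`, the Galois behaviour of `Λ`) is already prime-free. To stay
definition-free the points are an ∃-FAMILY `c : ℕ → E(ℚ̄_p)` with `c_m ∈ L(m) ∩ E₁`, `Λ(c_m) = ℓ_m`
(`exists_towerPoints`: at every prime, from the Honda points of file 1 at `ζ_{p^m} − 1`; for odd `p` the tree's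
`cPt p M hp2 htr` is such a family), and the generation / trace theorems are stated for ANY such family.

## What is proved (`M/ℤ_p` with elliptic generic and special fibre, `a_p(M) = 0`, ANY prime `p`; `Ω = ℚ̄_p`,
## `L(m)` = points with coordinates in `layer p m = ℚ_p(ζ_{p^m})`, `E₁ = kernel`, `Λ = ptLogΩ`, `ℓ_m = ell p m`)

* §1 `exists_frob_mem_layer_pred'`, `frob_layerField'`: `yᵖ ∈ 𝒪_{m−1} + p𝒪_m` for `y ∈ 𝒪_m`, every prime.
* §2 `exists_towerPoints`: a family `c` with `c_0 = O`, `c_m ∈ L(m) ∩ E₁`, `Λ(c_m) = ℓ_m` (Kobayashi's `c_m`, every `p`).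
* (file 3, `…LocalTowerGeneration`: for ANY such family, the closure correspondence, Kobayashi's generation step
  Prop. 8.11 ⇒ 8.12 ii) and the trace relations of Lemma 8.9, every prime.)
At `p = 2`, `a₂ = 0` these are Kobayashi §8.4 (Lemma 8.9, Prop. 8.11, Prop. 8.12 ii) generation half) along
`ℚ₂(ζ_{2^m})` — the μ_{2^∞}-tower inputs of the `2`-adic `±` Coleman theory (Kurihara–Otsuki 2006 p. 557,
asserted; Kitajima–Otsuki 2018 §3 shape with `k = ℚ₂`).

References: [Kobayashi2003] §8.4 (Lemma 8.9, Prop. 8.11, Prop. 8.12); [KuriharaOtsuki2006] p. 557, Prop. 1.4;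
[KitajimaOtsuki2018] §3.1–3.2; [SerreLocalFields1979] Ch. IV §4.
-/

set_option autoImplicit false
-- the Theorems namespace of this sub repeats the summit name by design (D-0017 nested layout)
set_option linter.dupNamespace false

noncomputable section

open scoped Classical Topology NNReal
open Filter PowerSeries Finset

namespace Summit.BirchSwinnertonDyer.BirchSwinnertonDyer.Theorems

namespace SignedKatoOffTwo.LocalAllPrimes

open Literature.RingTheory.FormalGroups WeierstrassCurve Field
open Summit.BirchSwinnertonDyer.Rank1Residual.Additive
open Summit.BirchSwinnertonDyer.Rank1Residual.Additive.PadicCyclotomicTower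
open Summit.BirchSwinnertonDyer.Rank1Residual.Additive.HondaFss
open Summit.BirchSwinnertonDyer.Rank1Residual.Additive.BallEval
open Literature.NumberTheory.GaloisRepresentations.LubinTate (unitBall mem_unitBall_iff)
open Literature.NumberTheory.EllipticCurves Literature.NumberTheory.EllipticCurves.FormalGroupChart

/-! ## §1 The Frobenius congruence in the cyclotomic tower, every prime -/

section Frob

variable (p : ℕ) [hp : Fact p.Prime]

/-- **Frobenius congruence in the cyclotomic tower, EVERY prime**: for `y ∈ layer m`, `‖y‖ ≤ 1`, `m ≥ 1`, there is
`s ∈ layer (m − 1)` with `‖s‖ ≤ 1` and `‖yᵖ − s‖ ≤ ‖p‖` (`y = ∑cⱼπʲ`, `yᵖ ≡ ∑cⱼᵖ(ζᵖ − 1)ʲ`, `ζᵖ = ζ_{m−1}`; the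
congruence `(ζ − 1)ᵖ ≡ ζᵖ − 1 (mod p)` holds at `p = 2` as well: `(ζ − 1)² = (ζ² − 1) − 2(ζ − 1)`). The tree's
`exists_frob_mem_layer_pred` is the case `p` odd. [cite: Kobayashi2003, Prop. 8.11] -/
theorem exists_frob_mem_layer_pred' {m : ℕ} (hm : 1 ≤ m) {y : PadicAlgCl p} (hy : y ∈ layer p m)
    (hy1 : ‖y‖ ≤ 1) : ∃ s ∈ layer p (m - 1), ‖s‖ ≤ 1 ∧ ‖y ^ p - s‖ ≤ ‖(p : PadicAlgCl p)‖ := by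
  obtain ⟨r, hr, hrc, hry⟩ := exists_intPoly_aeval_eq p hm hy hy1
  obtain ⟨m', rfl⟩ := Nat.exists_eq_add_of_le' hm
  rw [Nat.add_sub_cancel]
  set π : PadicAlgCl p := zeta p (m' + 1) - 1 with hπ
  set π' : PadicAlgCl p := zeta p m' - 1 with hπ'
  set e := (p ^ (m' + 1)).totient with he
  -- `y = ∑_{j<e} c_j π^j`
  have hysum : y = ∑ j ∈ range e, algebraMap ℚ_[p] (PadicAlgCl p) (r.coeff j) * π ^ j := by
    rw [← hry, Polynomial.aeval_eq_sum_range' hr]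
    simp only [Algebra.smul_def]
  set s : PadicAlgCl p := ∑ j ∈ range e, algebraMap ℚ_[p] (PadicAlgCl p) (r.coeff j) ^ p * π' ^ j with hs
  have hc1 : ∀ j, ‖algebraMap ℚ_[p] (PadicAlgCl p) (r.coeff j)‖ ≤ 1 := fun j => by
    rw [PadicAlgCl.norm_extends]; exact hrc j
  have hπ1 : ‖π‖ ≤ 1 := (norm_zeta_sub_one_lt_one p hm).le
  have hπ'1 : ‖π'‖ ≤ 1 := norm_zeta_sub_one_le_one p m'
  refine ⟨s, ?_, ?_, ?_⟩
  · -- `s ∈ layer m'`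
    refine Subalgebra.sum_mem _ fun j _ => ?_
    refine Subalgebra.mul_mem _ (Subalgebra.pow_mem _ (IntermediateField.algebraMap_mem _ _) _)
      (Subalgebra.pow_mem _ ?_ _)
    exact IntermediateField.sub_mem _ (zeta_mem_layer p m') (IntermediateField.one_mem _)
  · refine IsUltrametricDist.norm_sum_le_of_forall_le_of_nonneg zero_le_one fun j _ => ?_
    rw [norm_mul, norm_pow, norm_pow]
    calc ‖algebraMap ℚ_[p] (PadicAlgCl p) (r.coeff j)‖ ^ p * ‖π'‖ ^ j ≤ 1 * 1 :=
          mul_le_mul (pow_le_one₀ (norm_nonneg _) (hc1 j)) (pow_le_one₀ (norm_nonneg _) hπ'1) (by positivity)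
            zero_le_one
      _ = 1 := one_mul 1
  · -- `‖y^p − s‖ ≤ ‖p‖`: freshman's dream, then `π^{pj} ≡ π'^j`
    have hu : ∀ j ∈ range e, ‖algebraMap ℚ_[p] (PadicAlgCl p) (r.coeff j) * π ^ j‖ ≤ 1 := fun j _ => by
      rw [norm_mul, norm_pow]
      calc _ ≤ 1 * (1 : ℝ) := mul_le_mul (hc1 j) (pow_le_one₀ (norm_nonneg _) hπ1) (by positivity) zero_le_one
        _ = 1 := one_mul 1
    have h1 := norm_sum_pow_sub_sum_pow_le p (range e) _ hu
    rw [← hysum] at h1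
    have hππ' : ‖π ^ p - π'‖ ≤ ‖(p : PadicAlgCl p)‖ := by
      -- `(ζ − 1)^p = [(ζ + (−1))^p − ζ^p − (−1)^p] + [(−1)^p + 1] + (ζ' − 1)`, both brackets `≡ 0 (mod p)`
      have h := norm_add_pow_sub_le p (a := zeta p (m' + 1)) (b := -1) (by rw [norm_zeta]) (by rw [norm_neg, norm_one])
      have h2 : ‖((-1 : PadicAlgCl p)) ^ p + 1‖ ≤ ‖(p : PadicAlgCl p)‖ := by
        rcases hp.out.eq_two_or_odd' with h2 | hodd
        · subst h2
          have e2 : ((-1 : PadicAlgCl 2)) ^ 2 + 1 = ((2 : ℕ) : PadicAlgCl 2) := by norm_num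
          rw [e2]
        · rw [hodd.neg_one_pow, neg_add_cancel, norm_zero]; exact norm_nonneg _
      have e : π ^ p - π' = ((zeta p (m' + 1) + -1) ^ p - zeta p (m' + 1) ^ p - (-1) ^ p) + ((-1) ^ p + 1) := by
        rw [hπ, hπ', zeta_succ_pow, sub_eq_add_neg (zeta p (m' + 1)) 1]; ring
      rw [e]; exact (IsUltrametricDist.norm_add_le_max _ _).trans (max_le h h2)
    have h2 : ‖∑ j ∈ range e, (algebraMap ℚ_[p] (PadicAlgCl p) (r.coeff j) * π ^ j) ^ p - s‖ ≤ ‖(p : PadicAlgCl p)‖ := by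
      rw [hs, ← Finset.sum_sub_distrib]
      refine IsUltrametricDist.norm_sum_le_of_forall_le_of_nonneg (norm_nonneg _) fun j _ => ?_
      rw [mul_pow, ← pow_mul, mul_comm j p, pow_mul, ← mul_sub, norm_mul, norm_pow]
      calc ‖algebraMap ℚ_[p] (PadicAlgCl p) (r.coeff j)‖ ^ p * ‖(π ^ p) ^ j - π' ^ j‖ ≤ 1 * ‖(p : PadicAlgCl p)‖ := by
            refine mul_le_mul (pow_le_one₀ (norm_nonneg _) (hc1 j)) ?_ (norm_nonneg _) zero_le_one
            exact (norm_pow_sub_pow_le p (by rw [norm_pow]; exact pow_le_one₀ (norm_nonneg _) hπ1) hπ'1 j).trans hππ'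
        _ = ‖(p : PadicAlgCl p)‖ := one_mul _
    have e : y ^ p - s = (y ^ p - ∑ j ∈ range e, (algebraMap ℚ_[p] (PadicAlgCl p) (r.coeff j) * π ^ j) ^ p) +
        (∑ j ∈ range e, (algebraMap ℚ_[p] (PadicAlgCl p) (r.coeff j) * π ^ j) ^ p - s) := by ring
    rw [e]
    exact (IsUltrametricDist.norm_add_le_max _ _).trans (max_le h1 h2)

/-- The Frobenius hypothesis of file 1 for `(K_m, K_{m−1})` (`K_m = LayerField p m`), every prime.
[cite: Kobayashi2003, Prop. 8.11] -/
theorem frob_layerField' {m : ℕ} (hm : 1 ≤ m) (y : LayerField p m) (hy : ‖y‖ ≤ 1) :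
    ∃ s ∈ Subfield.comap (LayerField.emb p m).toRingHom (layer p (m - 1)).toSubfield,
      ‖s‖ ≤ 1 ∧ ‖y ^ p - s‖ ≤ ‖(p : LayerField p m)‖ := by
  have hy' : ‖LayerField.emb p m y‖ ≤ 1 := by rwa [LayerField.norm_emb]
  obtain ⟨s, hs, hs1, hys⟩ := exists_frob_mem_layer_pred' p hm (LayerField.emb_mem y) hy'
  refine ⟨LayerField.mk p m s (layer_mono p (Nat.sub_le m 1) hs), ?_, ?_, ?_⟩
  · change LayerField.emb p m (LayerField.mk p m s _) ∈ (layer p (m - 1)).toSubfield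
    rw [LayerField.emb_mk]; exact hs
  · rw [← LayerField.norm_emb, LayerField.emb_mk]; exact hs1
  · rw [← LayerField.norm_emb, map_sub, map_pow, LayerField.emb_mk, ← LayerField.norm_emb (p := p) (m := m) (p : LayerField p m),
      map_natCast]
    exact hys

end Frob

/-! ## §2 Kobayashi's points `c_m`, every prime -/

section Points

variable (p : ℕ) [hp : Fact p.Prime] (M : WeierstrassCurve ℤ_[p])
  [hE : (M.map PadicInt.Coe.ringHom).IsElliptic] [hEt : (M.map PadicInt.toZMod).IsElliptic]

variable [hintΩ : (genFibΩ p M).IsIntegral (Valued.v (R := PadicAlgCl p)).integer]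

/-- **Kobayashi's points at every prime**: for a good supersingular `a_p = 0` model there is a family
`c : ℕ → E(ℚ̄_p)` with `c_0 = O` and, for every `m`, `c_m ∈ L(m)` (coordinates in `ℚ_p(ζ_{p^m})`), `c_m ∈ E₁` and
`Λ(c_m) = ℓ_m = ∑_{k<m} (−1)ᵏ(ζ_{p^{m−2k}} − 1)/pᵏ` — the Honda points of `ζ_{p^m} − 1` (file 1 at every prime; for
odd `p` the tree's `cPt p M hp2 htr` is such a family). [cite: Kobayashi2003, §8.4, Lemma 8.9] -/
theorem exists_towerPoints (htr : Literature.NumberTheory.EllipticCurves.HasseManin.tr (M.map PadicInt.toZMod) = 0) :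
    ∃ c : ℕ → (genFibΩ p M).toAffine.Point, c 0 = 0 ∧ ∀ m,
      c m ∈ subfieldPoints (genFibΩ p M) (layer p m).toSubfield coeffs_mem_layer ∧
      c m ∈ kernel (Valued.v (R := PadicAlgCl p)) (genFibΩ p M) ∧ ptLogΩ p M (c m) = ell p m := by
  have h := norm_coeff_hondaPsi_le_one' p M htr
  let c : ℕ → (genFibΩ p M).toAffine.Point := fun m =>
    if hm : 1 ≤ m then toOmega p M m (ptOf p (LayerField p m) M
      (ev₁ p (LayerField p m) (towerParam p m) (hasEval_of_norm_lt_one (norm_towerParam_lt_one hm))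
        (liftInt (hondaPsi p M) h))
      (norm_ev₁_lt_one_of_constantCoeff (constantCoeff_liftInt_hondaPsi h) (norm_towerParam_lt_one hm))) else 0
  have hc0 : c 0 = 0 := by simp only [c]; rw [dif_neg (by omega)]
  refine ⟨c, hc0, fun m => ?_⟩
  by_cases hm : 1 ≤ m
  · haveI := isIntegral_curveK p (LayerField p m) M
    have hcm : c m = toOmega p M m (ptOf p (LayerField p m) M
        (ev₁ p (LayerField p m) (towerParam p m) (hasEval_of_norm_lt_one (norm_towerParam_lt_one hm))
          (liftInt (hondaPsi p M) h))
        (norm_ev₁_lt_one_of_constantCoeff (constantCoeff_liftInt_hondaPsi h) (norm_towerParam_lt_one hm))) := by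
      simp only [c]; rw [dif_pos hm]
    refine ⟨?_, ?_, ?_⟩
    · rw [hcm]; exact toOmega_mem_subfieldPoints _
    · rw [hcm]; exact (toOmega_mem_kernel_iff _).mpr (ptOf_mem_kernel _)
    · rw [hcm, ptLogΩ_toOmega (ptOf_mem_kernel _),
        ptLog_hondaPt'_eq_sum h (norm_towerParam_lt_one hm) (k₀ := m) ?_]
      · rw [map_sum, ell]
        refine sum_congr rfl fun k _ => ?_
        rw [logFssRow]
        simp only [map_div₀, map_mul, map_pow, map_neg, map_one, map_sub, map_add, map_natCast, emb_towerParam]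
        rw [add_sub_cancel, zeta_pow_sq_pow]
      · intro k hk
        apply LayerField.emb_injective
        rw [map_pow, map_add, map_one, emb_towerParam, add_sub_cancel]
        exact zeta_pow_eq_one_of_le p (by omega)
  · have h0 : m = 0 := by omega
    subst h0
    rw [hc0]
    exact ⟨(subfieldPoints _ _ _).zero_mem, (kernel (Valued.v (R := PadicAlgCl p)) (genFibΩ p M)).zero_mem,
      by rw [ptLogΩ_zero, ell_zero]⟩

end Points

end SignedKatoOffTwo.LocalAllPrimes

end Summit.BirchSwinnertonDyer.BirchSwinnertonDyer.Theorems

end
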